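import Summits.QuantumAdvantage.QuantumAdvantage.Theorems.SosSandwichTransferPBNodeStat
import Summits.QuantumAdvantage.QuantumAdvantage.Theorems.SosSandwichTransferPBNodeMargins
import Summits.QuantumAdvantage.QuantumAdvantage.Theorems.SosSandwichTransferPBKeyedLanguageP
import Literature.Computability.QuantumComplexity.OracleRemovalKernel
import Literature.Computability.QuantumComplexity.PolyBlockStatReadout
import Literature.Computability.Cryptography.ClassBQPProofs
import HarnessLib

/-!
# Crux `TransferPB` (stmt-QuantumAdvantage-15238, route SosSandwich), line `birth` — the node tests are in `PromiseBQP` (obligation (Q))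

The last obligation (Q) of stub `stub_pbOracleSimulation`: for a uniform oracle algorithm `F`, the node-test promise problem
`nodeProblem F r c k` (`Theorems/SosSandwichTransferPBMachineDefs.lean`: BLOCK `M_u(ρ) ≥ w` vs `≤ w/2`, SINGLE `m_s(ρ) ≥ w` vs
`≤ w/2`, MEAN `E[p_x|_ρ] ≥ j/40` vs `≤ (j−1)/40`) is in `PromiseBQP`. The machine (Aaronson–Ambainis 2014, proof of Thm. 23,
with the explicit `4T`-wise independent hash family of Zhandry 2012 and the truncated-run estimator of Bennett–Bernstein–Brassard–
Vazirani 1997): lay the instance out with `T(n)+1` copies of `x` (`layoutC`, `FP`); run the keyed truncated-runs blocks family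
`truncRun F nOfLayout` (uniform, `truncRun_family_isUniform`) whose oracle `keyedLang F ∈ P ⊆ BQP` is removed with every output
event controlled (`exists_oracleFree_kernelProb_close`); read the statistic `nodeStat` (`FP`, `exists_nodeStat_FP`) — on MEAN layouts
the answer wire of the full block (probability EXACTLY `E[p_x|_ρ]`, `kernelProb_truncRun_full_eq_nodeMean`), otherwise the `T`
indicators "query register of block `b` hits the target" (sum of probabilities EXACTLY `m_s(ρ)/4T`, resp. `M_u(ρ)/4T`,
`sum_kernelProb_truncRun_{query,prefix}_eq_{bbbvMag,blockMag}`) — and compare its mean with the threshold `nodeNum/nodeDen₁`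
(`(2j−1)/80`, resp. `3/(16·max(T,1)·W)`, `W = 1/w`) by `PolyCopies.mem_PromiseBQP_of_blockStat_thresholds_pre`, the removal error
`1/(q+1)`, `q = 160 (p_F+1)² W_poly`, being below every margin.

* `queryEv` (the block query event), `kernelProb_close_E` (oracle removal on block events), `bsMean_encMean` (MEAN layouts: mean
  of the statistic `= E[p_x|_ρ] ± 1/(q+1)`), `bsMean_query` (other layouts: `= Σ_b Pr[query event b] ± T/(q+1)`);
* `yes_query`, `no_query`, `yes_mean`, `no_mean` — the six threshold inequalities (denominator, margins and error polynomial from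
  `Theorems/SosSandwichTransferPBNodeMargins.lean`);
* **`nodeProblem_mem_PromiseBQP`** — `F.IsUniform → nodeProblem F r c k ∈ PromiseBQP`.

All proved; one explicit abbreviation (`queryEv`). No named fact. Sources: S. Aaronson, A. Ambainis, Theory Comput. 10 (2014),
proof of Thm. 23 (p. 14); C. H. Bennett, E. Bernstein, G. Brassard, U. Vazirani, SIAM J. Comput. 26 (1997), Cor. 3.4, Cor. 4.15;
M. Zhandry, CRYPTO 2012, Thm. 3.1; J. Watrous, arXiv:0804.3401, §IV.2 Prop. 3.
-/

-- D-0017: single-conjunct summit ⇒ the duplicate `QuantumAdvantage.QuantumAdvantage` is mandated.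
set_option linter.dupNamespace false

noncomputable section

namespace Summit.QuantumAdvantage.QuantumAdvantage.Cruxes.TransferPB.Birth

open Finset Literature.Computability.Cryptography Literature.Computability.Complexity
  Literature.Computability.Complexity.Brick Literature.Computability.Complexity.Plumb
  Literature.Computability.QuantumComplexity Literature.Computability.QuantumComplexity.ClassicalSimulation
  Literature.Computability.Cryptography.ExplicitKWiseHash
open _root_.Computability CodeFP Polynomial

namespace SimTreePB

variable (F : QCircuitFamily cliffordT) (r : Polynomial ℕ) (c k : ℕ)

/-! ### Oracle removal on block events -/

variable {F}

variable (F) in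
/-- **The query event of block `b` for the target set `D`**: the query register of the `b`-th oracle gate, read through the
block wires, spells a string of `D` (the event of `sum_kernelProb_truncRun_query_eq_bbbvMag` / `…prefix_eq_blockMag`).
[cite: BennettBernsteinBrassardVazirani1997, Def. 3.2] -/
abbrev queryEv (z : List Bool) (D : Set (List Bool))
    (b : Fin (oraclePositions (F.circ ((truncRun F nOfLayout).nOf z.length)).gates).length) : Set (List Bool) :=
  {s' | queryOf ((oraclePositions (F.circ ((truncRun F nOfLayout).nOf z.length)).gates)[(b : ℕ)]).2.2
      (fun i => s'.getD (((truncRun F nOfLayout).E z.length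
        ⟨b, by rw [KeyedBlocks.trunc_MOf, ← length_oraclePositions]; exact Nat.lt_succ_of_lt b.2⟩ i :
          Fin (z.length + (truncRun F nOfLayout).anc z.length)) : ℕ) false) ∈ D}

section Removal

variable {G : QCircuitFamily cliffordT} {q : Polynomial ℕ} {statU : List Bool → List Bool}
  (hstat : ∀ z s, statU (boolPair z s) = nodeStat F z s)
  (hclose : ∀ (z : List Bool) (E : Set (List Bool)),
    |G.kernelProb 0 z {y' | y'.take (z.length + (truncRun F nOfLayout).family.ancillas z.length) ∈ E} -
      (truncRun F nOfLayout).family.kernelProb (keyedLang F) z E| ≤ 1 / (((q.eval z.length : ℕ) : ℝ) + 1))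

include hclose in
/-- **Oracle removal on a block event**: an event read through the wires of one block is an event on the original output
wires, so the oracle-free substitute reproduces its probability up to `1/(q+1)`.
[cite: BennettBernsteinBrassardVazirani1997, Cor. 4.15] -/
theorem kernelProb_close_E (z : List Bool) (b : Fin ((truncRun F nOfLayout).MOf z.length))
    (Tp : (Fin ((truncRun F nOfLayout).nOf z.length + (truncRun F nOfLayout).mF z.length) → Bool) → Prop) :
    |G.kernelProb 0 z {s | Tp fun i => s.getD (((truncRun F nOfLayout).E z.length b i :
        Fin (z.length + (truncRun F nOfLayout).anc z.length)) : ℕ) false} -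
      (truncRun F nOfLayout).family.kernelProb (keyedLang F) z {s | Tp fun i => s.getD (((truncRun F nOfLayout).E z.length b i :
        Fin (z.length + (truncRun F nOfLayout).anc z.length)) : ℕ) false}| ≤ 1 / (((q.eval z.length : ℕ) : ℝ) + 1) := by
  have h := hclose z {s | Tp fun i => s.getD (((truncRun F nOfLayout).E z.length b i :
    Fin (z.length + (truncRun F nOfLayout).anc z.length)) : ℕ) false}
  have hset : {y' : List Bool | y'.take (z.length + (truncRun F nOfLayout).family.ancillas z.length) ∈
      {s : List Bool | Tp fun i => s.getD (((truncRun F nOfLayout).E z.length b i :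
        Fin (z.length + (truncRun F nOfLayout).anc z.length)) : ℕ) false}} =
      {s | Tp fun i => s.getD (((truncRun F nOfLayout).E z.length b i :
        Fin (z.length + (truncRun F nOfLayout).anc z.length)) : ℕ) false} := by
    ext y'
    simp only [Set.mem_setOf_eq]
    have hi : ∀ i, (y'.take (z.length + (truncRun F nOfLayout).family.ancillas z.length)).getD
        (((truncRun F nOfLayout).E z.length b i : Fin (z.length + (truncRun F nOfLayout).anc z.length)) : ℕ) false =
        y'.getD (((truncRun F nOfLayout).E z.length b i : Fin (z.length + (truncRun F nOfLayout).anc z.length)) : ℕ) false :=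
      fun i => by
        rw [List.getD_eq_getElem?_getD, List.getD_eq_getElem?_getD, List.getElem?_take_of_lt]
        exact ((truncRun F nOfLayout).E z.length b i).2
    simp only [hi]
  rwa [hset] at h

include hstat hclose in
/-- **MEAN layouts: the mean of the statistic is `E[p_x|_ρ]` up to `1/(q+1)`** (`kernelProb_truncRun_full_eq_nodeMean` through the
oracle removal). [cite: AaronsonAmbainis2014, Thm. 23 (proof, p. 14)] [cite: Zhandry2012IBE, Thm. 3.1] -/
theorem bsMean_encMean (x : List Bool) (ρ : List (Fin (numOracleBits F x) × Bool)) (j : ℕ) :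
    |PolyCopies.bsMean G statU (nodeM F) (layoutC F (encMean F x ρ j)) - nodeMean F x ρ| ≤
      1 / ((((q.eval (layoutC F (encMean F x ρ j)).length : ℕ) : ℝ)) + 1) := by
  have hm : isMeanC F (layoutC F (encMean F x ρ j)) = true := (node_layoutC_encMean F 0 0 0 x ρ j).1
  have hM : nodeM F (layoutC F (encMean F x ρ j)) = 1 := by simp [nodeM, hm]
  rw [PolyCopies.bsMean, hM, Finset.sum_range_one]
  have hev : {s : List Bool | (statU (boolPair (layoutC F (encMean F x ρ j)) s)).getD 0 false = true} =
      {s | (nodeStat F (layoutC F (encMean F x ρ j)) s).getD 0 false = true} := by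
    ext s; rw [Set.mem_setOf_eq, Set.mem_setOf_eq, hstat]
  rw [hev, setOf_nodeStat_mean F _ hm]
  have hP := kernelProb_truncRun_full_eq_nodeMean (F := F) nOfLayout (layoutC F (encMean F x ρ j)) x ρ
    (true :: List.replicate j true) (ones (padC F x.length (encMean F x ρ j).length)) (truncRun_nOf_layoutC F x _)
    ⟨(F.circ ((truncRun F nOfLayout).nOf (layoutC F (encMean F x ρ j)).length)).oracleQueries, by
      rw [KeyedBlocks.trunc_MOf]; exact Nat.lt_succ_self _⟩
    (le_of_eq (length_oraclePositions _)) (inpB_layoutC F x _ _) (drop_layoutC F x _)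
  have hc := kernelProb_close_E hclose (layoutC F (encMean F x ρ j))
    ⟨(F.circ ((truncRun F nOfLayout).nOf (layoutC F (encMean F x ρ j)).length)).oracleQueries, by
      rw [KeyedBlocks.trunc_MOf]; exact Nat.lt_succ_self _⟩ (fun u => [true] <+: List.ofFn u)
  rw [hP] at hc
  exact hc

include hstat hclose in
/-- **Non-MEAN layouts: the mean of the statistic is the sum of the query-event probabilities up to `T/(q+1)`.**
[cite: BennettBernsteinBrassardVazirani1997, Cor. 3.4 (proof)] [cite: Zhandry2012IBE, Thm. 3.1] -/
theorem bsMean_query (z : List Bool) (hm : isMeanC F z = false) (D : Set (List Bool))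
    (hD : ∀ q' : List Bool, targetTest F z q' = true ↔ q' ∈ D) :
    |PolyCopies.bsMean G statU (nodeM F) z -
      ∑ b : Fin (oraclePositions (F.circ ((truncRun F nOfLayout).nOf z.length)).gates).length,
        (truncRun F nOfLayout).family.kernelProb (keyedLang F) z (queryEv F z D b)| ≤
      ((oraclePositions (F.circ ((truncRun F nOfLayout).nOf z.length)).gates).length : ℝ) *
        (1 / (((q.eval z.length : ℕ) : ℝ) + 1)) := by
  have hM : nodeM F z = (oraclePositions (F.circ ((truncRun F nOfLayout).nOf z.length)).gates).length := by
    rw [nodeM, hm, length_oraclePositions]; rfl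
  rw [PolyCopies.bsMean, hM, ← Fin.sum_univ_eq_sum_range]
  have hev : ∀ b : Fin (oraclePositions (F.circ ((truncRun F nOfLayout).nOf z.length)).gates).length,
      {s' : List Bool | (statU (boolPair z s')).getD b false = true} = queryEv F z D b := by
    intro b; ext s'
    rw [Set.mem_setOf_eq, hstat, nodeStat_getD_query F z s' hm b, hD]
    rfl
  simp only [hev]
  rw [← Finset.sum_sub_distrib]
  refine (Finset.abs_sum_le_sum_abs _ _).trans ?_
  have hb : ∀ b : Fin (oraclePositions (F.circ ((truncRun F nOfLayout).nOf z.length)).gates).length,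
      |G.kernelProb 0 z (queryEv F z D b) - (truncRun F nOfLayout).family.kernelProb (keyedLang F) z (queryEv F z D b)| ≤
        1 / (((q.eval z.length : ℕ) : ℝ) + 1) := fun b =>
    kernelProb_close_E hclose z
      ⟨(b : ℕ), by rw [KeyedBlocks.trunc_MOf, ← length_oraclePositions]; exact Nat.lt_succ_of_lt b.2⟩
      (fun u => queryOf ((oraclePositions (F.circ ((truncRun F nOfLayout).nOf z.length)).gates)[(b : ℕ)]).2.2 u ∈ D)
  refine (Finset.sum_le_sum fun b _ => hb b).trans ?_
  simp

end Removal

section Cases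

variable {G : QCircuitFamily cliffordT} {p : Polynomial ℕ} {statU : List Bool → List Bool}
  (hp : ∀ n, (F.circ n).size ≤ p.eval n ∧ F.ancillas n ≤ p.eval n)
  (hstat : ∀ z s, statU (boolPair z s) = nodeStat F z s)
  (hclose : ∀ (z : List Bool) (E : Set (List Bool)),
    |G.kernelProb 0 z {y' | y'.take (z.length + (truncRun F nOfLayout).family.ancillas z.length) ∈ E} -
      (truncRun F nOfLayout).family.kernelProb (keyedLang F) z E| ≤ 1 / ((((errPoly r c k p).eval z.length : ℕ) : ℝ) + 1))

include hp hstat hclose in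
/-- **YES side of a magnitude test** (SINGLE or BLOCK layout `z` of `⟨x, w⟩`, magnitude `M ≥ w`, `4T · Σ_b Pr = M`).
[cite: AaronsonAmbainis2014, Thm. 23 (proof, p. 14)] -/
theorem yes_query (x w : List Bool) (hm : isMeanC F (layoutC F (boolPair x w)) = false)
    (hnum : nodeNum F (layoutC F (boolPair x w)) = 3)
    (hden : nodeDen₁ F r c k (layoutC F (boolPair x w)) =
      16 * padOne (F.circ x.length).oracleQueries * bitsToNat (wDenFn F r c k (ones x.length)))
    (D : Set (List Bool)) (hD : ∀ q' : List Bool, targetTest F (layoutC F (boolPair x w)) q' = true ↔ q' ∈ D) (M : ℝ)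
    (hSP : 4 * ((F.circ x.length).oracleQueries : ℝ) *
      ∑ b : Fin (oraclePositions (F.circ ((truncRun F nOfLayout).nOf (layoutC F (boolPair x w)).length)).gates).length,
        (truncRun F nOfLayout).family.kernelProb (keyedLang F) (layoutC F (boolPair x w)) (queryEv F (layoutC F (boolPair x w)) D b) = M)
    (hyes : pbThreshold F x r c k ≤ M) :
    ((nodeNum F (layoutC F (boolPair x w)) : ℕ) : ℝ) / ((nodeDen₁ F r c k (layoutC F (boolPair x w)) : ℕ) : ℝ) +
        1 / ((((errPoly r c k p).eval (layoutC F (boolPair x w)).length : ℕ) : ℝ) + 1) ≤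
      PolyCopies.bsMean G statU (nodeM F) (layoutC F (boolPair x w)) := by
  have hWpos : (0 : ℝ) < bitsToNat (wDenFn F r c k (ones x.length)) := by exact_mod_cast wDenFn_pos F r c k (ones x.length)
  have hn : (truncRun F nOfLayout).nOf (layoutC F (boolPair x w)).length = x.length := truncRun_nOf_layoutC F x w
  have hcl := bsMean_query hstat hclose (layoutC F (boolPair x w)) hm D hD
  have hlen : ((oraclePositions (F.circ ((truncRun F nOfLayout).nOf (layoutC F (boolPair x w)).length)).gates).length : ℝ) =
      ((F.circ x.length).oracleQueries : ℝ) := by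
    rw [length_oraclePositions]; exact congrArg (fun n : ℕ => (((F.circ n).oracleQueries : ℕ) : ℝ)) hn
  rw [hlen, abs_le] at hcl
  have hε := err_le_margin F r c k hp x w
  rw [pbThreshold_eq_inv_wDenFn_ones] at hyes
  rw [hnum, hden]
  -- generalize the heavy terms away before the arithmetic
  generalize (∑ b : Fin (oraclePositions (F.circ ((truncRun F nOfLayout).nOf (layoutC F (boolPair x w)).length)).gates).length,
      (truncRun F nOfLayout).family.kernelProb (keyedLang F) (layoutC F (boolPair x w)) (queryEv F (layoutC F (boolPair x w)) D b)) = S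
    at hSP hcl
  generalize PolyCopies.bsMean G statU (nodeM F) (layoutC F (boolPair x w)) = B at hcl ⊢
  generalize (errPoly r c k p).eval (layoutC F (boolPair x w)).length = Q at hcl hε ⊢
  generalize bitsToNat (wDenFn F r c k (ones x.length)) = W at hWpos hyes hε ⊢
  generalize (F.circ x.length).oracleQueries = T at hSP hcl hε ⊢
  exact yes_query_core T W Q S B M hWpos hcl hε hSP hyes

include hp hstat hclose in
/-- **NO side of a magnitude test** (magnitude `M ≤ w/2`). [cite: AaronsonAmbainis2014, Thm. 23 (proof, p. 14)] -/
theorem no_query (x w : List Bool) (hm : isMeanC F (layoutC F (boolPair x w)) = false)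
    (hnum : nodeNum F (layoutC F (boolPair x w)) = 3)
    (hden : nodeDen₁ F r c k (layoutC F (boolPair x w)) =
      16 * padOne (F.circ x.length).oracleQueries * bitsToNat (wDenFn F r c k (ones x.length)))
    (D : Set (List Bool)) (hD : ∀ q' : List Bool, targetTest F (layoutC F (boolPair x w)) q' = true ↔ q' ∈ D) (M : ℝ)
    (hSP : 4 * ((F.circ x.length).oracleQueries : ℝ) *
      ∑ b : Fin (oraclePositions (F.circ ((truncRun F nOfLayout).nOf (layoutC F (boolPair x w)).length)).gates).length,
        (truncRun F nOfLayout).family.kernelProb (keyedLang F) (layoutC F (boolPair x w)) (queryEv F (layoutC F (boolPair x w)) D b) = M)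
    (hno : M ≤ pbThreshold F x r c k / 2) :
    PolyCopies.bsMean G statU (nodeM F) (layoutC F (boolPair x w)) ≤
      ((nodeNum F (layoutC F (boolPair x w)) : ℕ) : ℝ) / ((nodeDen₁ F r c k (layoutC F (boolPair x w)) : ℕ) : ℝ) -
        1 / ((((errPoly r c k p).eval (layoutC F (boolPair x w)).length : ℕ) : ℝ) + 1) := by
  have hWpos : (0 : ℝ) < bitsToNat (wDenFn F r c k (ones x.length)) := by exact_mod_cast wDenFn_pos F r c k (ones x.length)
  have hn : (truncRun F nOfLayout).nOf (layoutC F (boolPair x w)).length = x.length := truncRun_nOf_layoutC F x w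
  have hcl := bsMean_query hstat hclose (layoutC F (boolPair x w)) hm D hD
  have hlenN : (oraclePositions (F.circ ((truncRun F nOfLayout).nOf (layoutC F (boolPair x w)).length)).gates).length =
      (F.circ x.length).oracleQueries := by
    rw [length_oraclePositions]; exact congrArg (fun n : ℕ => (F.circ n).oracleQueries) hn
  have hlen : ((oraclePositions (F.circ ((truncRun F nOfLayout).nOf (layoutC F (boolPair x w)).length)).gates).length : ℝ) =
      ((F.circ x.length).oracleQueries : ℝ) := by exact_mod_cast hlenN
  rw [hlen, abs_le] at hcl
  have hε := err_le_margin F r c k hp x w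
  rw [pbThreshold_eq_inv_wDenFn_ones] at hno
  rw [hnum, hden]
  -- the sum is `0` when there is no oracle gate (empty index type)
  have hsum0 : (F.circ x.length).oracleQueries = 0 →
      (∑ b : Fin (oraclePositions (F.circ ((truncRun F nOfLayout).nOf (layoutC F (boolPair x w)).length)).gates).length,
        (truncRun F nOfLayout).family.kernelProb (keyedLang F) (layoutC F (boolPair x w))
          (queryEv F (layoutC F (boolPair x w)) D b)) = 0 := fun h0 =>
    Finset.sum_eq_zero fun b _ => absurd (lt_of_lt_of_eq b.2 (hlenN.trans h0)) (Nat.not_lt_zero _)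
  -- generalize the heavy terms away before the arithmetic
  generalize (∑ b : Fin (oraclePositions (F.circ ((truncRun F nOfLayout).nOf (layoutC F (boolPair x w)).length)).gates).length,
      (truncRun F nOfLayout).family.kernelProb (keyedLang F) (layoutC F (boolPair x w)) (queryEv F (layoutC F (boolPair x w)) D b)) = S
    at hSP hcl hsum0
  generalize PolyCopies.bsMean G statU (nodeM F) (layoutC F (boolPair x w)) = B at hcl ⊢
  generalize (errPoly r c k p).eval (layoutC F (boolPair x w)).length = Q at hcl hε ⊢
  generalize bitsToNat (wDenFn F r c k (ones x.length)) = W at hWpos hno hε ⊢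
  generalize (F.circ x.length).oracleQueries = T at hSP hcl hε hsum0 ⊢
  rcases Nat.eq_zero_or_pos T with h0 | hT1
  · -- no oracle gate: the statistic is empty
    subst h0
    rw [hsum0 rfl] at hcl
    exact no_query_core_zero W Q B hWpos hcl.2 hε
  · exact no_query_core_pos T W Q S B M hT1 hWpos hcl.2 hε hSP hno

include hstat hclose in
/-- **YES side of a MEAN test.** [cite: AaronsonAmbainis2014, Thm. 23 (proof, p. 14)] -/
theorem yes_mean (x : List Bool) (ρ : List (Fin (numOracleBits F x) × Bool)) (j : ℕ) (hj1 : 1 ≤ j)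
    (hyes : (j : ℝ) / 40 ≤ nodeMean F x ρ) :
    ((nodeNum F (layoutC F (encMean F x ρ j)) : ℕ) : ℝ) / ((nodeDen₁ F r c k (layoutC F (encMean F x ρ j)) : ℕ) : ℝ) +
        1 / ((((errPoly r c k p).eval (layoutC F (encMean F x ρ j)).length : ℕ) : ℝ) + 1) ≤
      PolyCopies.bsMean G statU (nodeM F) (layoutC F (encMean F x ρ j)) := by
  rw [(node_layoutC_encMean F r c k x ρ j).2.1, nodeDen₁_layoutC_encMean]
  have hcl := bsMean_encMean hstat hclose x ρ j
  have hε := err_le_160 r c k p (layoutC F (encMean F x ρ j)).length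
  rw [abs_le] at hcl
  generalize PolyCopies.bsMean G statU (nodeM F) (layoutC F (encMean F x ρ j)) = B at hcl ⊢
  generalize (errPoly r c k p).eval (layoutC F (encMean F x ρ j)).length = Q at hcl hε ⊢
  generalize nodeMean F x ρ = μ at hcl hyes
  have hcast : ((2 * j - 1 : ℕ) : ℝ) = 2 * (j : ℝ) - 1 := by
    rw [Nat.cast_sub (by omega), Nat.cast_mul]; norm_num
  rw [hcast]
  push_cast
  linarith [hcl.1]

include hstat hclose in
/-- **NO side of a MEAN test.** [cite: AaronsonAmbainis2014, Thm. 23 (proof, p. 14)] -/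
theorem no_mean (x : List Bool) (ρ : List (Fin (numOracleBits F x) × Bool)) (j : ℕ) (hj1 : 1 ≤ j)
    (hno : nodeMean F x ρ ≤ ((j : ℝ) - 1) / 40) :
    PolyCopies.bsMean G statU (nodeM F) (layoutC F (encMean F x ρ j)) ≤
      ((nodeNum F (layoutC F (encMean F x ρ j)) : ℕ) : ℝ) / ((nodeDen₁ F r c k (layoutC F (encMean F x ρ j)) : ℕ) : ℝ) -
        1 / ((((errPoly r c k p).eval (layoutC F (encMean F x ρ j)).length : ℕ) : ℝ) + 1) := by
  rw [(node_layoutC_encMean F r c k x ρ j).2.1, nodeDen₁_layoutC_encMean]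
  have hcl := bsMean_encMean hstat hclose x ρ j
  have hε := err_le_160 r c k p (layoutC F (encMean F x ρ j)).length
  rw [abs_le] at hcl
  generalize PolyCopies.bsMean G statU (nodeM F) (layoutC F (encMean F x ρ j)) = B at hcl ⊢
  generalize (errPoly r c k p).eval (layoutC F (encMean F x ρ j)).length = Q at hcl hε ⊢
  generalize nodeMean F x ρ = μ at hcl hno
  have hcast : ((2 * j - 1 : ℕ) : ℝ) = 2 * (j : ℝ) - 1 := by
    rw [Nat.cast_sub (by omega), Nat.cast_mul]; norm_num
  rw [hcast]
  push_cast
  linarith [hcl.2]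

end Cases

/-! ### The `PromiseBQP` membership -/

/-- SINGLE layouts: the target test is membership in `{σ(s)}`. [cite: AaronsonAmbainis2014, Thm. 23 (proof, p. 14)] -/
theorem targetTest_encSingle_iff (x : List Bool) (ρ : List (Fin (numOracleBits F x) × Bool)) (s : Fin (numOracleBits F x))
    (q' : List Bool) : targetTest F (layoutC F (encSingle F x ρ s)) q' = true ↔ q' ∈ ({bitString F x s} : Set (List Bool)) := by
  rw [targetTest_layoutC_encSingle]; exact decide_eq_true_iff

open scoped Classical in
/-- BLOCK layouts: the target test is membership in `{σ(s) : u ⊑ σ(s)}`. [cite: AaronsonAmbainis2014, Thm. 23 (proof, p. 14)] -/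
theorem targetTest_encBlock_iff (x : List Bool) (ρ : List (Fin (numOracleBits F x) × Bool)) (u q' : List Bool) :
    targetTest F (layoutC F (encBlock F x ρ u)) q' = true ↔
      q' ∈ {q'' : List Bool | ∃ s ∈ univ.filter (fun s : Fin (numOracleBits F x) => u <+: bitString F x s), bitString F x s = q''} := by
  rw [targetTest_layoutC_encBlock]; exact decide_eq_true_iff

/-- **The node tests are in `PromiseBQP` (obligation (Q) of stub `stub_pbOracleSimulation`), for a uniform `F`.**
[cite: AaronsonAmbainis2014, Thm. 23 (proof, p. 14)] [cite: BennettBernsteinBrassardVazirani1997, Cor. 3.4, Cor. 4.15]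
[cite: Zhandry2012IBE, Thm. 3.1] [cite: Watrous2009, §IV.2 Prop. 3] -/
theorem nodeProblem_mem_PromiseBQP (hF : F.IsUniform) : nodeProblem F r c k ∈ PromiseBQP := by
  classical
  obtain ⟨pF, hpF⟩ := hF.isPolySize'
  have hA : keyedLang F ∈ BQP := P_subset_BQP_holds (keyedLang_mem_P hF)
  have hU : (truncRun F nOfLayout).family.IsUniform := truncRun_family_isUniform hF codeFP_nOfLayout
  obtain ⟨G, hGfree, hGU, hclose⟩ := exists_oracleFree_kernelProb_close hA hU (errPoly r c k pF)
  obtain ⟨statU, hstatFP, hstat⟩ := exists_nodeStat_FP hF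
  obtain ⟨num, hnumFP, hnum⟩ := nodeNumC hF
  obtain ⟨den, hdenFP, hden⟩ := nodeDen₁C r c k hF
  have hden' : ∀ z, bitsToNat (den z) = nodeDen₁ F r c k z := fun z => by
    rw [show den z = natE _ from hden z]; exact bitsToNat_natE _
  have hnum' : ∀ z, bitsToNat (num z) = nodeNum F z := fun z => by
    rw [show num z = natE _ from hnum z]; exact bitsToNat_natE _
  refine mem_PromiseBQP_of_blockStat_thresholds_pre (nodeProblem F r c k) (layoutC_mem_FP hF) hGfree hGU hstatFP hnumFP
    hdenFP (nodeM F) (fun z s _ => by rw [hstat, length_nodeStat]) (errPoly r c k pF)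
    (fun v _ => by rw [hden']; exact nodeDen₁_pos F r c k _) (fun v _ => by rw [hden']; exact nodeDen₁_pos F r c k _)
    (fun v hv => ?_) (fun v hv => ?_)
  · -- YES instances
    rw [hnum', hden']
    obtain ⟨x, ρ, hv⟩ := hv
    rcases hv with ⟨u, rfl, hyes⟩ | ⟨s, rfl, hyes⟩ | ⟨j, rfl, hj1, -, hyes⟩
    · exact yes_query r c k hpF hstat hclose x _ (node_layoutC_encBlock F r c k x ρ u).1 (node_layoutC_encBlock F r c k x ρ u).2.1
        (nodeDen₁_layoutC_encBlock F r c k x ρ u) _ (targetTest_encBlock_iff x ρ u) _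
        (sum_kernelProb_truncRun_prefix_eq_blockMag (F := F) nOfLayout (layoutC F (encBlock F x ρ u)) x ρ (false :: false :: u)
          (ones (padC F x.length (encBlock F x ρ u).length)) (truncRun_nOf_layoutC F x _) (inpB_layoutC F x _)
          (drop_layoutC F x _) u) hyes
    · exact yes_query r c k hpF hstat hclose x _ (node_layoutC_encSingle F r c k x ρ s).1 (node_layoutC_encSingle F r c k x ρ s).2.1
        (nodeDen₁_layoutC_encSingle F r c k x ρ s) _ (targetTest_encSingle_iff x ρ s) _
        (sum_kernelProb_truncRun_query_eq_bbbvMag (F := F) nOfLayout (layoutC F (encSingle F x ρ s)) x ρ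
          (false :: true :: bitString F x s) (ones (padC F x.length (encSingle F x ρ s).length)) (truncRun_nOf_layoutC F x _)
          (inpB_layoutC F x _) (drop_layoutC F x _) s) hyes
    · exact yes_mean r c k hstat hclose x ρ j hj1 hyes
  · -- NO instances
    rw [hnum', hden']
    obtain ⟨x, ρ, hv⟩ := hv
    rcases hv with ⟨u, rfl, hno⟩ | ⟨s, rfl, hno⟩ | ⟨j, rfl, hj1, -, hno⟩
    · exact no_query r c k hpF hstat hclose x _ (node_layoutC_encBlock F r c k x ρ u).1 (node_layoutC_encBlock F r c k x ρ u).2.1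
        (nodeDen₁_layoutC_encBlock F r c k x ρ u) _ (targetTest_encBlock_iff x ρ u) _
        (sum_kernelProb_truncRun_prefix_eq_blockMag (F := F) nOfLayout (layoutC F (encBlock F x ρ u)) x ρ (false :: false :: u)
          (ones (padC F x.length (encBlock F x ρ u).length)) (truncRun_nOf_layoutC F x _) (inpB_layoutC F x _)
          (drop_layoutC F x _) u) hno
    · exact no_query r c k hpF hstat hclose x _ (node_layoutC_encSingle F r c k x ρ s).1 (node_layoutC_encSingle F r c k x ρ s).2.1
        (nodeDen₁_layoutC_encSingle F r c k x ρ s) _ (targetTest_encSingle_iff x ρ s) _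
        (sum_kernelProb_truncRun_query_eq_bbbvMag (F := F) nOfLayout (layoutC F (encSingle F x ρ s)) x ρ
          (false :: true :: bitString F x s) (ones (padC F x.length (encSingle F x ρ s).length)) (truncRun_nOf_layoutC F x _)
          (inpB_layoutC F x _) (drop_layoutC F x _) s) hno
    · exact no_mean r c k hstat hclose x ρ j hj1 hno

end SimTreePB

end Summit.QuantumAdvantage.QuantumAdvantage.Cruxes.TransferPB.Birth

end
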